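import Literature.MathematicalPhysics.QuantumFieldTheory.ConstructiveQFTWave0SiteRPProofs
import Literature.MathematicalPhysics.QuantumFieldTheory.LatticeGaugeProofs
import HarnessLib

/-!
# The reflection-positivity form of the site reflection: invariance and Cauchy–Schwarz

Companion of `ConstructiveQFTWave0SiteRPProofs` (reflection positivity of the torus Wilson
measure for the reflection `θ' t = -t` in the lattice hyperplanes `t = 0`, `t = L/2`,
`wilsonExpectation_siteReflectionPositive`). This file adds the two further ingredients of the
Osterwalder–Schrader inner product of the lattice theory (Osterwalder–Seiler, Ann. Phys. 110
(1978) 440, §2; Seiler, LNP 159 (1982), Ch. 2) for that reflection: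

* **`Θ'`-invariance of the Wilson measure** (`WilsonSiteRP.wilsonAction_negReflect`,
  `wilsonMeasure_map_negReflect`, `integral_comp_negReflect_wilsonMeasure`);
* the **positive-semidefinite Hermitian form** `B(F₁, F₂) = ∑ₖ ⟨conj F₁ₖ(Θ'U) · F₂ₖ(U)⟩_{Λ,β}` on
  finite families of bounded measurable observables of the closed half `{0 ≤ t ≤ L/2}`
  (`WilsonSiteRP.IsHalfObs`, `siteRPForm`): positivity (`siteRPForm_self_nonneg`, from the root
  theorem), Hermitian symmetry (`siteRPForm_conj_symm`, from the invariance and `Θ'² = 1`), and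
  the **Cauchy–Schwarz inequality** `|B(F₁,F₂)|² ≤ Re B(F₁,F₁) · Re B(F₂,F₂)`
  (`normSq_siteRPForm_le`, via the expansion of `B(F₁ + tF₂, F₁ + tF₂)` and the scalar lemma
  `normSq_le_mul_of_forall_quadratic`).

All statements here are proved. [folklore]
-/

open MeasureTheory Finset Complex
open scoped ComplexOrder ENNReal ComplexConjugate

namespace Literature.MathematicalPhysics.QuantumFieldTheory

noncomputable section

namespace WilsonSiteRP

open WilsonRP

/-! ## `Θ'`-invariance of the Wilson measure -/

section Invariance

variable {d L N : ℕ} [NeZero d] [NeZero L] [Fact (1 < L)]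
variable {G : Type*} [Group G] [TopologicalSpace G] [IsTopologicalGroup G] [CompactSpace G]
  [MeasurableSpace G] [BorelSpace G]
variable (ρ : G →* Matrix (Fin N) (Fin N) ℂ)

omit [NeZero L] [Fact (1 < L)] [TopologicalSpace G] [IsTopologicalGroup G] [CompactSpace G]
  [MeasurableSpace G] [BorelSpace G] in
/-- `Θ'` is an involution on configurations. [folklore] -/
@[simp] theorem negReflect_negReflect_config (U : GaugeConfig d L G) : U.negReflect.negReflect = U := by
  funext e
  have h2 : (siteEdgeReflect e).2 = e.2 := by
    unfold siteEdgeReflect; split_ifs with h <;> simp [h]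
  rw [negReflect_apply, negReflect_apply, h2, siteEdgeReflect_siteEdgeReflect]
  split_ifs <;> simp

omit [MeasurableSpace G] [BorelSpace G] in
/-- **The Wilson action is `Θ'`-invariant**: `S(Θ'U) = S(U)`. [folklore] -/
theorem wilsonAction_negReflect (hL : Even L) (hρ : Continuous ρ) (U : GaugeConfig d L G) :
    wilsonAction ρ U.negReflect = wilsonAction ρ U := by
  rw [wilsonAction_siteSplit ρ hL hρ, wilsonAction_siteSplit ρ hL hρ U, negReflect_negReflect_config,
    sharedAction_negReflect ρ hL]
  ring

omit [Fact (1 < L)] [CompactSpace G] in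
/-- `Θ'` as a measurable equivalence of the configuration space. [folklore] -/
def negReflectEquiv : GaugeConfig d L G ≃ᵐ GaugeConfig d L G where
  toFun := GaugeConfig.negReflect
  invFun := GaugeConfig.negReflect
  left_inv := negReflect_negReflect_config
  right_inv := negReflect_negReflect_config
  measurable_toFun := measurable_negReflect
  measurable_invFun := measurable_negReflect

/-- **The Wilson measure is `Θ'`-invariant**: `μ_{Λ,β} ∘ Θ'⁻¹ = μ_{Λ,β}` (product Haar measure and
Boltzmann weight are both invariant). [folklore] -/
theorem wilsonMeasure_map_negReflect (hL : Even L) (hρ : Continuous ρ) (β : ℝ) :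
    (wilsonMeasure (d := d) (L := L) ρ β).map GaugeConfig.negReflect = wilsonMeasure ρ β := by
  have hbase : (Measure.pi fun _ : Edge d L => haarProbability G).map
      (negReflectEquiv (d := d) (L := L) (G := G)) = Measure.pi fun _ => haarProbability G :=
    (measurePreserving_negReflect (d := d) (L := L) (G := G)).map_eq
  have hw := WilsonGauge.withDensity_map_equiv_of_invariant
    (Measure.pi fun _ : Edge d L => haarProbability G) negReflectEquiv
    (fun U => ENNReal.ofReal (Real.exp (-β * wilsonAction ρ U))) hbase
    (fun U => by
      show ENNReal.ofReal (Real.exp (-β * wilsonAction ρ (GaugeConfig.negReflect U))) = _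
      rw [wilsonAction_negReflect ρ hL hρ])
  unfold wilsonMeasure
  rw [Measure.map_smul]
  exact congrArg _ hw

/-- Change of variables under the reflection: `∫ f(Θ'U) dμ_{Λ,β} = ∫ f dμ_{Λ,β}`. [folklore] -/
theorem integral_comp_negReflect_wilsonMeasure (hL : Even L) (hρ : Continuous ρ) (β : ℝ)
    {E : Type*} [NormedAddCommGroup E] [NormedSpace ℝ E] (f : GaugeConfig d L G → E) :
    ∫ U, f U.negReflect ∂(wilsonMeasure ρ β) = ∫ U, f U ∂(wilsonMeasure ρ β) := by
  have h := MeasureTheory.integral_map_equiv (negReflectEquiv (d := d) (L := L) (G := G))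
    (μ := wilsonMeasure ρ β) f
  have he : ⇑(negReflectEquiv (d := d) (L := L) (G := G)) = GaugeConfig.negReflect := rfl
  rw [he, wilsonMeasure_map_negReflect ρ hL hρ β] at h
  exact h.symm

end Invariance

/-! ## The positive-semidefinite Hermitian form and the Cauchy–Schwarz inequality -/

section CauchySchwarz

/-- **Scalar Cauchy–Schwarz**: if `a, c ≥ 0` and `a + 2 Re(t b) + |t|² c ≥ 0` for every complex
`t`, then `|b|² ≤ a c`. [folklore] -/
theorem normSq_le_mul_of_forall_quadratic {a c : ℝ} {b : ℂ} (ha : 0 ≤ a) (hc : 0 ≤ c)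
    (h : ∀ t : ℂ, 0 ≤ a + 2 * (t * b).re + ‖t‖ ^ 2 * c) : ‖b‖ ^ 2 ≤ a * c := by
  have hb2 : ((starRingEnd ℂ) b * b).re = ‖b‖ ^ 2 := by
    rw [mul_comm, Complex.mul_conj, Complex.normSq_eq_norm_sq]; norm_cast
  rcases hc.lt_or_eq with hc | hc
  · -- `t = -conj b / c`
    have key := h (-(starRingEnd ℂ) b / c)
    have h1 : (-(starRingEnd ℂ) b / c * b).re = -(‖b‖ ^ 2 / c) := by
      rw [div_mul_eq_mul_div, neg_mul, neg_div, Complex.neg_re, Complex.div_ofReal_re, hb2]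
    have h2 : ‖-(starRingEnd ℂ) b / (c : ℂ)‖ ^ 2 = ‖b‖ ^ 2 / c ^ 2 := by
      rw [norm_div, norm_neg, Complex.norm_conj, Complex.norm_real, Real.norm_eq_abs,
        abs_of_pos hc, div_pow]
    rw [h1, h2] at key
    have key' : 0 ≤ a - ‖b‖ ^ 2 / c := by
      have : a + 2 * -(‖b‖ ^ 2 / c) + ‖b‖ ^ 2 / c ^ 2 * c = a - ‖b‖ ^ 2 / c := by
        field_simp; ring
      linarith [this]
    rw [sub_nonneg, div_le_iff₀ hc] at key'
    linarith
  · -- `c = 0`: then `b = 0`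
    subst hc
    rw [mul_zero]
    by_contra hb
    have hb0 : 0 < ‖b‖ ^ 2 := not_le.1 hb
    have hb1 : ‖b‖ ^ 2 ≠ 0 := hb0.ne'
    have key := h (-(((a + 1) / (2 * ‖b‖ ^ 2) : ℝ) : ℂ) * (starRingEnd ℂ) b)
    have h1 : (-(((a + 1) / (2 * ‖b‖ ^ 2) : ℝ) : ℂ) * (starRingEnd ℂ) b * b).re = -((a + 1) / 2) := by
      have hbn : ‖b‖ ≠ 0 := fun h0 => hb1 (by rw [h0, zero_pow two_ne_zero])
      rw [mul_assoc, neg_mul, Complex.neg_re, Complex.re_ofReal_mul, hb2]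
      rw [show (a + 1) / (2 * ‖b‖ ^ 2) * ‖b‖ ^ 2 = (a + 1) / 2 by field_simp]
    rw [h1, mul_zero, add_zero] at key
    linarith

variable {d L N : ℕ} [NeZero d] [NeZero L] [Fact (1 < L)]
variable {G : Type*} [Group G] [TopologicalSpace G] [IsTopologicalGroup G] [CompactSpace G]
  [MeasurableSpace G] [BorelSpace G]
variable (ρ : G →* Matrix (Fin N) (Fin N) ℂ)

/-- Admissible half-observables for the reflection in lattice hyperplanes: bounded measurable
functions of the links of the closed half `{0 ≤ t ≤ L/2}` (`P' ∪ M`). [folklore] -/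
structure IsHalfObs (F : GaugeConfig d L G → ℂ) : Prop where
  measurable : Measurable F
  bounded : ∃ C : ℝ, ∀ U, ‖F U‖ ≤ C
  dependsOn : DependsOn F ((sitePosEdges ∪ sharedEdges : Finset (Edge d L)) : Set (Edge d L))

omit [Fact (1 < L)] [Group G] [TopologicalSpace G] [IsTopologicalGroup G] [CompactSpace G]
  [BorelSpace G] in
/-- Linear combinations of admissible half-observables are admissible. [folklore] -/
theorem IsHalfObs.add_smul {F₁ F₂ : GaugeConfig d L G → ℂ} (h₁ : IsHalfObs F₁) (h₂ : IsHalfObs F₂)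
    (t : ℂ) : IsHalfObs (fun U => F₁ U + t * F₂ U) := by
  obtain ⟨C₁, hC₁⟩ := h₁.bounded
  obtain ⟨C₂, hC₂⟩ := h₂.bounded
  refine ⟨h₁.measurable.add (h₂.measurable.const_mul t), ⟨C₁ + ‖t‖ * C₂, fun U => ?_⟩,
    fun U V hUV => by simp only [h₁.dependsOn hUV, h₂.dependsOn hUV]⟩
  calc ‖F₁ U + t * F₂ U‖ ≤ ‖F₁ U‖ + ‖t * F₂ U‖ := norm_add_le _ _
    _ ≤ C₁ + ‖t‖ * C₂ := by rw [norm_mul]; gcongr; exacts [hC₁ U, hC₂ U]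

/-- The reflection-positivity form on finite families of observables:
`B(F₁, F₂) = ∑ₖ ⟨conj F₁ₖ(Θ'U) · F₂ₖ(U)⟩_{Λ,β}` (the Osterwalder–Schrader inner product of the lattice
theory for the site reflection; Osterwalder–Seiler 1978 §2, Seiler LNP 159 Ch. 2). [folklore] -/
def siteRPForm (β : ℝ) {κ : Type*} [Fintype κ] (F₁ F₂ : κ → GaugeConfig d L G → ℂ) : ℂ :=
  ∑ k, ∫ U, (starRingEnd ℂ) (F₁ k U.negReflect) * F₂ k U ∂(wilsonMeasure ρ β)

variable {κ : Type*} [Fintype κ]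

omit [Fact (1 < L)] in
/-- **Positivity**: `B(F, F) ≥ 0` for admissible families. [folklore] -/
theorem siteRPForm_self_nonneg (hL : Even L) (hρ : Continuous ρ) (β : ℝ)
    {F : κ → GaugeConfig d L G → ℂ} (hF : ∀ k, IsHalfObs (F k)) : 0 ≤ siteRPForm ρ β F F :=
  Finset.sum_nonneg fun k _ => wilsonExpectation_siteReflectionPositive ρ hL hρ β (F k)
    (hF k).measurable (hF k).bounded (hF k).dependsOn

/-- **Hermitian symmetry**: `B(F₂, F₁) = conj B(F₁, F₂)` (from the `Θ'`-invariance of the Wilson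
measure and `Θ'² = 1`). [folklore] -/
theorem siteRPForm_conj_symm (hL : Even L) (hρ : Continuous ρ) (β : ℝ)
    (F₁ F₂ : κ → GaugeConfig d L G → ℂ) :
    siteRPForm ρ β F₂ F₁ = (starRingEnd ℂ) (siteRPForm ρ β F₁ F₂) := by
  unfold siteRPForm
  rw [map_sum]
  refine Finset.sum_congr rfl fun k _ => ?_
  rw [← integral_conj]
  simp only [map_mul, Complex.conj_conj]
  rw [← integral_comp_negReflect_wilsonMeasure ρ hL hρ β
    (fun U => F₁ k U.negReflect * (starRingEnd ℂ) (F₂ k U))]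
  refine integral_congr_ae (ae_of_all _ fun U => ?_)
  simp only [negReflect_negReflect_config]
  ring

omit [Fact (1 < L)] in
/-- Integrability of the products entering the form. [folklore] -/
theorem integrable_conj_negReflect_mul (hρ : Continuous ρ) (β : ℝ) {F₁ F₂ : GaugeConfig d L G → ℂ}
    (h₁ : IsHalfObs F₁) (h₂ : IsHalfObs F₂) :
    Integrable (fun U => (starRingEnd ℂ) (F₁ U.negReflect) * F₂ U) (wilsonMeasure ρ β) := by
  haveI := isProbabilityMeasure_wilsonMeasure (d := d) (L := L) ρ hρ β
  obtain ⟨C₁, hC₁⟩ := h₁.bounded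
  obtain ⟨C₂, hC₂⟩ := h₂.bounded
  refine Integrable.of_bound ((Complex.continuous_conj.measurable.comp
    (h₁.measurable.comp measurable_negReflect)).mul h₂.measurable).aestronglyMeasurable (C₁ * C₂)
    (ae_of_all _ fun U => ?_)
  rw [norm_mul, Complex.norm_conj]
  exact mul_le_mul (hC₁ _) (hC₂ _) (norm_nonneg _) ((norm_nonneg _).trans (hC₁ U.negReflect))

omit [Fact (1 < L)] in
/-- **Expansion of `B(F₁ + t F₂, F₁ + t F₂)`**. [folklore] -/
theorem siteRPForm_add_smul (hρ : Continuous ρ) (β : ℝ) {F₁ F₂ : κ → GaugeConfig d L G → ℂ}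
    (h₁ : ∀ k, IsHalfObs (F₁ k)) (h₂ : ∀ k, IsHalfObs (F₂ k)) (t : ℂ) :
    siteRPForm ρ β (fun k U => F₁ k U + t * F₂ k U) (fun k U => F₁ k U + t * F₂ k U) =
      siteRPForm ρ β F₁ F₁ + t * siteRPForm ρ β F₁ F₂ + (starRingEnd ℂ) t * siteRPForm ρ β F₂ F₁ +
        (starRingEnd ℂ) t * t * siteRPForm ρ β F₂ F₂ := by
  unfold siteRPForm
  rw [Finset.mul_sum, Finset.mul_sum, Finset.mul_sum, ← Finset.sum_add_distrib,
    ← Finset.sum_add_distrib, ← Finset.sum_add_distrib]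
  refine Finset.sum_congr rfl fun k _ => ?_
  have i11 := integrable_conj_negReflect_mul ρ hρ β (h₁ k) (h₁ k)
  have i12 := integrable_conj_negReflect_mul ρ hρ β (h₁ k) (h₂ k)
  have i21 := integrable_conj_negReflect_mul ρ hρ β (h₂ k) (h₁ k)
  have i22 := integrable_conj_negReflect_mul ρ hρ β (h₂ k) (h₂ k)
  have iA : Integrable (fun U => (starRingEnd ℂ) (F₁ k U.negReflect) * F₁ k U +
      t * ((starRingEnd ℂ) (F₁ k U.negReflect) * F₂ k U)) (wilsonMeasure ρ β) :=
    i11.add (i12.const_mul t)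
  have iB : Integrable (fun U =>
      (starRingEnd ℂ) t * ((starRingEnd ℂ) (F₂ k U.negReflect) * F₁ k U) +
      (starRingEnd ℂ) t * t * ((starRingEnd ℂ) (F₂ k U.negReflect) * F₂ k U)) (wilsonMeasure ρ β) :=
    (i21.const_mul _).add (i22.const_mul _)
  calc ∫ U, (starRingEnd ℂ) (F₁ k U.negReflect + t * F₂ k U.negReflect) *
          (F₁ k U + t * F₂ k U) ∂(wilsonMeasure ρ β)
      = ∫ U, ((starRingEnd ℂ) (F₁ k U.negReflect) * F₁ k U +
            t * ((starRingEnd ℂ) (F₁ k U.negReflect) * F₂ k U)) +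
          ((starRingEnd ℂ) t * ((starRingEnd ℂ) (F₂ k U.negReflect) * F₁ k U) +
            (starRingEnd ℂ) t * t * ((starRingEnd ℂ) (F₂ k U.negReflect) * F₂ k U))
          ∂(wilsonMeasure ρ β) := by
        refine integral_congr_ae (ae_of_all _ fun U => ?_)
        simp only [map_add, map_mul]
        ring
    _ = (∫ U, (starRingEnd ℂ) (F₁ k U.negReflect) * F₁ k U ∂(wilsonMeasure ρ β) +
          t * ∫ U, (starRingEnd ℂ) (F₁ k U.negReflect) * F₂ k U ∂(wilsonMeasure ρ β)) +
        ((starRingEnd ℂ) t * ∫ U, (starRingEnd ℂ) (F₂ k U.negReflect) * F₁ k U ∂(wilsonMeasure ρ β) +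
          (starRingEnd ℂ) t * t *
            ∫ U, (starRingEnd ℂ) (F₂ k U.negReflect) * F₂ k U ∂(wilsonMeasure ρ β)) := by
        rw [integral_add iA iB, integral_add i11 (i12.const_mul t),
          integral_add (i21.const_mul _) (i22.const_mul _), integral_const_mul, integral_const_mul,
          integral_const_mul]
    _ = _ := by ring

/-- **Cauchy–Schwarz for the reflection-positivity form**: for admissible families,
`|B(F₁, F₂)|² ≤ Re B(F₁, F₁) · Re B(F₂, F₂)` (Osterwalder–Seiler 1978 §2; Seiler LNP 159 Ch. 2,
the Schwarz inequality of the Osterwalder–Schrader inner product). [folklore] -/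
theorem normSq_siteRPForm_le (hL : Even L) (hρ : Continuous ρ) (β : ℝ)
    {F₁ F₂ : κ → GaugeConfig d L G → ℂ} (h₁ : ∀ k, IsHalfObs (F₁ k)) (h₂ : ∀ k, IsHalfObs (F₂ k)) :
    ‖siteRPForm ρ β F₁ F₂‖ ^ 2 ≤ (siteRPForm ρ β F₁ F₁).re * (siteRPForm ρ β F₂ F₂).re := by
  have ha := siteRPForm_self_nonneg ρ hL hρ β h₁
  have hc := siteRPForm_self_nonneg ρ hL hρ β h₂
  refine normSq_le_mul_of_forall_quadratic (Complex.nonneg_iff.1 ha).1 (Complex.nonneg_iff.1 hc).1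
    fun t => ?_
  have hH := siteRPForm_self_nonneg ρ hL hρ β fun k => (h₁ k).add_smul (h₂ k) t
  rw [siteRPForm_add_smul ρ hρ β h₁ h₂ t, siteRPForm_conj_symm ρ hL hρ β F₁ F₂] at hH
  have hb : ((starRingEnd ℂ) t * (starRingEnd ℂ) (siteRPForm ρ β F₁ F₂)).re =
      (t * siteRPForm ρ β F₁ F₂).re := by
    rw [← map_mul, Complex.conj_re]
  have ht : ((starRingEnd ℂ) t * t).re = ‖t‖ ^ 2 := by
    rw [mul_comm, Complex.mul_conj, Complex.normSq_eq_norm_sq]; norm_cast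
  have ht' : ((starRingEnd ℂ) t * t).im = 0 := by
    rw [mul_comm, Complex.mul_conj]; norm_cast
  have key : 0 ≤ (siteRPForm ρ β F₁ F₁).re + (t * siteRPForm ρ β F₁ F₂).re +
      ((starRingEnd ℂ) t * (starRingEnd ℂ) (siteRPForm ρ β F₁ F₂)).re +
      (((starRingEnd ℂ) t * t).re * (siteRPForm ρ β F₂ F₂).re -
        ((starRingEnd ℂ) t * t).im * (siteRPForm ρ β F₂ F₂).im) := by
    have := (Complex.nonneg_iff.1 hH).1
    simpa only [Complex.add_re, Complex.mul_re] using this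
  rw [hb, ht, ht', zero_mul, sub_zero] at key
  linarith

end CauchySchwarz

end WilsonSiteRP

end

end Literature.MathematicalPhysics.QuantumFieldTheory
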